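import Summits.AnomalousDissipation.AnomalousDissipation.Theorems.SolenoidalFractalHomogenisationRealisedQuasiStaticCellLawStrongAtCell
import HarnessLib

/-!
# K2R `RealisedQuasiStaticCellLaw`, line `floquet-bloch`: the registered stub `stub_lowSectorStrong` (S road)
# (`--supports stmt-AnomalousDissipation-20446`)

Summits-side file (everything proved; no definitions, no named facts). The registered stub of skeleton r17/r18, verbatim:
for every `δ > 0`, with `M₀ = 10 + 10¹⁸/δ²`, `ν₀ = 1`, `K = 8π²·3720·M(1 + c_W) + 30000`, every sector `±ℓ + nℤ³`
(`n ≥ ⌈K/ν⌉`) having a representative `k ≠ 0` with `|k|² < 1 + (1−δ)c_W/ν²` and `(δ/10⁴)·nν ≤ ‖k‖` (strong coupling)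
decays under the replayed cell word at the rate `8π²(1 + (1−δ)c_W/ν²)ν/n²` with prefactor `K/ν` — by
`strong_decay_at_cell` applied to the representative `k` (`sector_iff_of_rep`; `δ ≤ 1` is forced by `1 ≤ |k|²`).
-/

set_option linter.dupNamespace false

noncomputable section

namespace Summit.AnomalousDissipation.AnomalousDissipation.Theorems.SolenoidalFractalHomogenisation.RealisedQuasiStaticCellLaw

open Set MeasureTheory
open Literature.Analysis Literature.Analysis.FunctionSpaces Literature.Analysis.FunctionSpaces.Torus
open Literature.Analysis.FluidPDE Literature.Analysis.FluidPDE.LatticeShear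

/-- **Stub `stub_lowSectorStrong` of skeleton r17 (S road), registered signature.** -/
theorem stub_lowSectorStrong : ∀ δ > (0:ℝ), ∃ M₀ > (0:ℝ), ∀ M : ℝ, ∀ hM : 0 < M, M₀ ≤ M → ∃ ν₀ > (0:ℝ), ∃ K > (0:ℝ),
    ∀ ν, ∀ hν : ν ∈ Ioo 0 ν₀, ∀ n : ℕ, ⌈K / ν⌉₊ ≤ n → ∀ ℓ : Fin 3 → ℤ,
    (∃ k : Fin 3 → ℤ, ((∃ z : Fin 3 → ℤ, k = ℓ + (n:ℤ) • z) ∨ (∃ z : Fin 3 → ℤ, k = -ℓ + (n:ℤ) • z)) ∧ k ≠ 0 ∧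
      FunctionSpaces.Torus.freqNormSq k < 1 + (1 - δ) * ((1 - 4 * cubatureWord.ramp / 3) * c0) / ν ^ 2 ∧
      δ / 10000 * ((n:ℝ) * ν) ≤ ‖FunctionSpaces.Torus.latticeVec k‖) →
    ∀ w₀ : UnitAddTorus (Fin 3) → EuclideanSpace ℝ (Fin 3),
      FunctionSpaces.Torus.MemSobolev 1 (FunctionSpaces.EuclideanSpace.complexify ∘ w₀) →
      FunctionSpaces.Torus.IsWeaklyDivFree w₀ → FunctionSpaces.Torus.HasZeroMean w₀ →
      (∀ k : Fin 3 → ℤ, ¬ ((∃ z : Fin 3 → ℤ, k = ℓ + (n:ℤ) • z) ∨ (∃ z : Fin 3 → ℤ, k = -ℓ + (n:ℤ) • z)) →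
        UnitAddTorus.mFourierCoeff (FunctionSpaces.EuclideanSpace.complexify ∘ w₀) k = 0) → ∀ T > (0:ℝ), ∀ w,
      Torus.IsWeakPassiveVectorOn 0 T (ν / (n:ℝ) ^ 2)
          (((cubatureWord.stretch M hM).stretch (1 / ν) (one_div_pos.mpr hν.1)).cell n) w₀ w →
      ∀ᵐ t ∂(volume.restrict (Ioo 0 T)),
        ∫ x, ‖w t x‖ ^ 2 ≤ (K / ν) *
          Real.exp (-(8 * Real.pi ^ 2 * (1 + (1 - δ) * ((1 - 4 * cubatureWord.ramp / 3) * c0) / ν ^ 2) * ν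
            / (n:ℝ) ^ 2) * t) * ∫ x, ‖w₀ x‖ ^ 2 := by
  intro δ hδ
  have hρ : cubatureWord.ramp = 1 / 2 := (cubature_phase_fields 0).2.2.2
  have hcW : 0 < (1 - 4 * cubatureWord.ramp / 3) * c0 := by have := c0_pos; rw [hρ]; positivity
  refine ⟨10 + 10 ^ 18 / δ ^ 2, by positivity, fun M hM hM0 => ⟨1, one_pos,
    8 * Real.pi ^ 2 * 3720 * M * (1 + (1 - 4 * cubatureWord.ramp / 3) * c0) + 30000, by positivity, ?_⟩⟩
  intro ν hν n hn ℓ hsec w₀ hw₀ hdiv hmean hsupp T hT w hw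
  obtain ⟨k, hkℓ, hk0, hkQ, hkbig⟩ := hsec
  have hM10 : 10 ≤ M := by have : 0 ≤ 10 ^ 18 / δ ^ 2 := by positivity
                           linarith
  have hMδ : 10 ^ 18 / δ ^ 2 ≤ M := by linarith
  -- `δ ≤ 1`: otherwise `1 ≤ |k|² < 1 + (1 − δ)c_W/ν² ≤ 1`
  have hδ1 : δ ≤ 1 := by
    by_contra h
    have h1 : (1 - δ) * ((1 - 4 * cubatureWord.ramp / 3) * c0) / ν ^ 2 < 0 :=
      div_neg_of_neg_of_pos (mul_neg_of_neg_of_pos (by linarith) hcW) (by have := hν.1; positivity)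
    have h2 : 1 ≤ freqNormSq k := by
      rw [← norm_latticeVec_sq]; have := one_le_norm_latticeVec hk0; nlinarith
    linarith
  have hKn : 8 * Real.pi ^ 2 * 3720 * M * (1 + (1 - 4 * cubatureWord.ramp / 3) * c0) + 30000 ≤ (n : ℝ) * ν :=
    (div_le_iff₀ hν.1).mp (Nat.ceil_le.mp hn)
  have hsupp' : ∀ k' : Fin 3 → ℤ, ¬ ((∃ z : Fin 3 → ℤ, k' = k + (n:ℤ) • z) ∨ (∃ z : Fin 3 → ℤ, k' = -k + (n:ℤ) • z)) →
      UnitAddTorus.mFourierCoeff (FunctionSpaces.EuclideanSpace.complexify ∘ w₀) k' = 0 :=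
    fun k' hk' => hsupp k' fun h => hk' ((sector_iff_of_rep hkℓ k').mp h)
  exact strong_decay_at_cell hδ hδ1 hM hM10 hMδ hν.1 hν.2.le hKn k hk0 hkbig hkQ hw₀ hdiv hmean hsupp' hT hw

end Summit.AnomalousDissipation.AnomalousDissipation.Theorems.SolenoidalFractalHomogenisation.RealisedQuasiStaticCellLaw

end
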